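import Mathlib
import HarnessLib
import Literature.MathematicalPhysics.QuantumLattice.HubbardUVCovarianceCTTimeMoment
import Summits.HubbardSuperconductivity.HubbardSuperconductivity.Theorems.KLProgrammeKLRegimeEngineScaleZeroE4SpaceMoment
import Summits.HubbardSuperconductivity.HubbardSuperconductivity.Theorems.KLProgrammeKLRegimeEngineScaleZeroValuesExplicit
import Summits.HubbardSuperconductivity.HubbardSuperconductivity.Theorems.KLProgrammeKLRegimeEngineScaleZeroMixedDecay

/-!
# Route `KLProgramme` — crux K3, child 4 VL (`KLRegimeVolumeLimitV17F2`, stmt-HubbardSuperconductivity-20440), located risk #8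
# «(VL)-DEAD-LEG ≡ VL-OBSERVABLE-SECTOR», repair (R-src)/(α)-AUGMENTED: the COVARIANCE DATA of the UV-dressed propagator
# `C^K_{>Λ} = hubbardCovAboveCT V M β μ 0 K Λ` at EVERY cutoff `0 < Λ ≤ e₀` — mass, first TIME moment, first SPACE moment —
# uniform in the volume `L` and in the Matsubara cutoff `M` (Benfatto–Giuliani–Mastropietro 2006, (4.8b) at `j ∈ {0,1}`)

Cell gate-hubbard-kl, seat hubbard-kl-k3c4-p2 g10 (technique «Matsubara all-U route»; pen rulings (R59t)(ii)/(R59u)/(R59aa): the one-volume,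
`L`-uniform masses/tails of `G^{(h)} = Σ_{j ≥ h} g^{(j)}`, the dressing of the source/dead legs in k3c4-p1's `D^{(h)} = 𝒱^{(h)} ∘ (ψ ↦ ψ + C_{>h}φ)`,
i.e. the `T = τ_h` data of `TwoVolumeDefect.sum_norm_kernel_map_sub_glue_map_le_of_defect`).  The tree already holds every SYMBOL-LEVEL estimate
at a free cutoff `Λ` (the scale-`0` chain was written for `uvSymbolCT L M β μ K Λ`): `HubbardUVCovarianceCTDecayBound.rowSum_gridSub_hubbardCovAboveCT_le`
(mass), `HubbardUVCovarianceCTTimeMoment.timeMoment_charSum_uvSymbolCT_le` (time moment), `HubbardUVBandPieces.spaceMoment_basePiece_le /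
spaceMoment_incrPiece_le` + `…EngineScaleZeroE4SpaceMoment.scaledIncrQ_le/scaledIncrQ'_le` (space moment, telescoped over the frame pieces); the
Summits-side packagings (`ScaleZeroDecay.alpha_scaleZero_le`, `timeMoment_scaleZero_of_frameOK`, `EngineV8.spaceMoment_scaleZero_of_frameOK`) fixed
`Λ = klE0` and the `4M` grid.  This file re-keys them to ANY `0 < Λ ≤ klE0` (so to every `Λ_h = klScale klE0 h`, `klScale_klE0_le_klE0`) and ANY
time grid `N ≥ 2M` (the space-time lattice `SpaceTimeIdx V M` is `N = 2M`), for admissible frames `FrameOK`, in the GRID currency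
`G := (hubbardGridSub V M β N)ᵀ · C^K_{>Λ} · hubbardGridSub V M β N` / character sums `S[G_σ](a,b⃗)` of the padded symbol:

* §1 **mass**: `alpha_uvCov_row_le` / `alpha_uvCov_col_le` — `(β/N)·Σ_Y ‖G X Y‖ ≤ 14·√((½ + 12/Λ)(2/Λ + 128π⁴K₂²/Λ + 2π⁵K₂²/Λ² + 1 + π⁴K_x²/Λ³))`,
  `K₂ = 4B₂ + 6B₁ + 2`, `K_x = 7²K₂(2/Λ) + 7(2B₁+1)`; `rowSum_uvCov_le` / `colSum_uvCov_le` at the tree's numerals `B₁ = 32/3`, `B₂ = 1110`;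
* §2 **time moment**: `timeMoment_uvCov_of_frameOK` — `(β/N)·Σ_{a,b⃗} (β/N)|ã|·‖S[G_σ](a,b⃗)‖ ≤ uvTimeMomentConst Λ 7 R` (any `0 < Λ`, `R ≥ 1`);
* (§3, companion file `…UVCovarianceSpaceMomentAt`) **space moment**: `spaceMoment_uvCov_of_frameOK` —
  `(β/N)·Σ_{a,b⃗} |b̃_l|·‖S[G_σ](a,b⃗)‖ ≤ X₀(Λ,B) + X_lin(Λ,B)·4608·(1+ΣGfr)⁴·((N_sc+1)U² + 2|U|)` (any `0 < Λ ≤ 4`).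

All constants are closed expressions in `(Λ, B₁, B₂, B, R.Gfr, N_sc, U)` — free of `L`, of `M` (above `β³ ≤ M`), of `N`, `μ`, and of the frame.
Dependence on `Λ` (hence on `β` and the scale `h` at `Λ = Λ_h ≥ Λ_{n_β+1} ≍ π/β`) is polynomial in `1/Λ` and is ALLOWED by the consumer
(VL-ROUTE-A-RADIUS-g9 §3: the VL stub closes rate-free; only `L`-uniformity matters).  The weighted rows / tails / the `SpaceTimeIdx` currency are
assembled from these three in `…UVCovarianceWeightedRowsAt`.  Everything is proved; no definitions, no named facts.
-/

noncomputable section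

namespace Summit.HubbardSuperconductivity.HubbardSuperconductivity.Theorems.UVCovarianceAt

set_option linter.dupNamespace false -- summit = problem name (single-conjunct summit), D-0017

open Real Finset Literature.MathematicalPhysics.QuantumLattice Literature.Probability.LatticeModels
open Literature.MathematicalPhysics.QuantumLattice.FermiRG
open Summit.HubbardSuperconductivity.HubbardSuperconductivity.Theorems.KLRegimeSplit
open Summit.HubbardSuperconductivity.HubbardSuperconductivity.Theorems.DispersionFlow
open Summit.HubbardSuperconductivity.HubbardSuperconductivity.Theorems.ScaleZeroDecay
open Summit.HubbardSuperconductivity.HubbardSuperconductivity.Theorems.EngineV8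
open Summit.HubbardSuperconductivity.HubbardSuperconductivity.Theorems.KLProgrammeLegKernels

variable {L M N : ℕ}

/-! ## §0 The KL scales are admissible cutoffs -/

/-- `0 < klScale klE0 h ≤ klE0 ≤ 4` for every scale index `h`: the three cutoff hypotheses of this file at `Λ = Λ_h`. -/
theorem klScale_admissible (h : ℕ) : 0 < klScale klE0 h ∧ klScale klE0 h ≤ klE0 ∧ klScale klE0 h ≤ 4 := by
  have he : (0 : ℝ) < klE0 := by norm_num [klE0]
  have h4 : (1 : ℝ) ≤ (4 : ℝ) ^ h := one_le_pow₀ (by norm_num)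
  have hle : klScale klE0 h ≤ klE0 := by
    unfold klScale
    calc klE0 * ((4 : ℝ) ^ h)⁻¹ ≤ klE0 * 1 := mul_le_mul_of_nonneg_left (inv_le_one_of_one_le₀ h4) he.le
      _ = klE0 := mul_one _
  refine ⟨?_, hle, hle.trans (by norm_num [klE0])⟩
  unfold klScale
  positivity

/-! ## §1 The mass (plain row and column sums) at every cutoff `0 < Λ ≤ klE0` and every grid `N ≥ 2M` -/

section Alpha

variable [NeZero L] [NeZero N] {R : RenConsts} {U : ℝ} {Nsc : ℕ} {μ : ℝ} {K : TrigPolyC4v} {β Λ : ℝ} {B₁ B₂ : ℝ}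

omit [NeZero N] in
/-- The radicand estimate shared by rows and columns: at `s₀ = βΛ/N`, `klBetaMin ≤ β`, `β³ ≤ M`, `2M ≤ N`, `0 < Λ ≤ klE0`,
`(β/N)²·(2+12/s₀)·14²·N·L²·[ℓ²-terms] ≤ 196·(½ + 12/Λ)·(2/Λ + 128π⁴K₂²/Λ + 2π⁵K₂²/Λ² + 1 + π⁴K_x²/Λ³)`. -/
theorem radicand_uvCov_le (hβ : klBetaMin ≤ β) (hB₁ : ∀ x, |deriv salmhoferCutoff x| ≤ B₁) (hB₂ : ∀ x, |deriv (deriv salmhoferCutoff) x| ≤ B₂)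
    (hβM : β ^ 3 ≤ (M : ℝ)) (hΛ : 0 < Λ) (hΛe : Λ ≤ klE0) (hMN : 2 * M ≤ N) :
    (β / N) ^ 2 * (((2 + 12 / (β * Λ / N)) * 14 ^ 2) * ((N : ℝ) ^ 1 * (L : ℝ) ^ 2 *
      ((L : ℝ) ^ 2 * ((1 / (β * (L : ℝ) ^ 2)) ^ 2 * (2 * β / Λ)) +
        ((N : ℝ) * (β * Λ / N) / 4) ^ 4 *
          ((L : ℝ) ^ 2 * ((1 / (β * (L : ℝ) ^ 2)) ^ 2 * (2 * Real.pi / β) ^ 4 * (4 * B₂ + 6 * B₁ + 2) ^ 2 *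
              (64 * ((2 / Λ) ^ 4 * (2 * β / Λ)) + (2 / Λ) ^ 6 * (64 * Real.pi))) +
            4 * ((L : ℝ) ^ 2 * (4 * ((1 / (β * (L : ℝ) ^ 2)) ^ 2 * ((β * (L : ℝ) ^ 2) * (β / (Real.pi * (2 * M - 3)))))) ^ 2)) +
        2 * (((L : ℝ) / 4) ^ 4 * ((L : ℝ) ^ 2 * ((1 / (β * (L : ℝ) ^ 2)) ^ 2 * (2 * Real.pi / L) ^ 4 *
          ((7 : ℝ) ^ 2 * (4 * B₂ + 6 * B₁ + 2) * (2 / Λ) + 7 * (2 * B₁ + 1)) ^ 2 * ((2 / Λ) ^ (2 * 1) * (2 * β / Λ)))))))) ≤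
      196 * ((1 / 2 + 12 / Λ) *
        (2 / Λ + 128 * Real.pi ^ 4 * (4 * B₂ + 6 * B₁ + 2) ^ 2 / Λ + 2 * Real.pi ^ 5 * (4 * B₂ + 6 * B₁ + 2) ^ 2 / Λ ^ 2 + 1 +
          Real.pi ^ 4 * ((7 : ℝ) ^ 2 * (4 * B₂ + 6 * B₁ + 2) * (2 / Λ) + 7 * (2 * B₁ + 1)) ^ 2 / Λ ^ 3)) := by
  have hβ0 : 0 < β := beta_pos_of_klBetaMin_le hβ
  have hβ128 : (128 : ℝ) ≤ β := by simpa [klBetaMin] using hβ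
  have hL : (0 : ℝ) < L := by exact_mod_cast Nat.pos_of_ne_zero (NeZero.ne L)
  have hβ3 : β ≤ β ^ 3 := by nlinarith [sq_nonneg β]
  have hMr : β ≤ (M : ℝ) := hβ3.trans hβM
  have hNr : 2 * (M : ℝ) ≤ N := by exact_mod_cast hMN
  have hN0 : 0 < (N : ℝ) := by linarith
  rw [radicand_scaleZero_eq hN0.ne' hL.ne' hβ0.ne' hΛ.ne' (by linarith)]
  refine mul_le_mul_of_nonneg_left ?_ (by norm_num)
  have hB10 : 0 ≤ B₁ := (abs_nonneg _).trans (hB₁ 0)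
  have hB20 : 0 ≤ B₂ := (abs_nonneg _).trans (hB₂ 0)
  have h1 : 2 * β / N + 12 / Λ ≤ 1 / 2 + 12 / Λ := by
    have h2β : 2 * β ≤ β ^ 3 := by nlinarith [sq_nonneg β]
    have : 2 * β / N ≤ 1 / 2 := by rw [div_le_iff₀ hN0]; linarith
    linarith
  have hT3 : 256 * Real.pi ^ 5 * (4 * B₂ + 6 * B₁ + 2) ^ 2 / (β * Λ ^ 2) ≤
      2 * Real.pi ^ 5 * (4 * B₂ + 6 * B₁ + 2) ^ 2 / Λ ^ 2 := by
    rw [div_le_div_iff₀ (by positivity) (by positivity)]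
    have : 0 ≤ Real.pi ^ 5 * (4 * B₂ + 6 * B₁ + 2) ^ 2 * Λ ^ 2 := by positivity
    nlinarith
  have hT4 : β ^ 5 * Λ ^ 4 / (4 * Real.pi ^ 2 * (2 * M - 3) ^ 2) ≤ 1 := by
    have hM' : β ^ 3 ≤ 2 * (M : ℝ) - 3 := by linarith
    have h6 : (β ^ 3) ^ 2 ≤ (2 * (M : ℝ) - 3) ^ 2 := pow_le_pow_left₀ (by positivity) hM' 2
    have hπ2 : 9 ≤ Real.pi ^ 2 := by nlinarith [Real.pi_gt_three]
    have hden : (0 : ℝ) < 4 * Real.pi ^ 2 * (2 * M - 3) ^ 2 := by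
      have : (0 : ℝ) < 2 * M - 3 := by linarith
      positivity
    have hΛ4 : Λ ^ 4 ≤ (1 : ℝ) / 2 ^ 20 := by
      calc Λ ^ 4 ≤ klE0 ^ 4 := pow_le_pow_left₀ hΛ.le hΛe 4
        _ = 1 / 2 ^ 20 := by norm_num [klE0]
    rw [div_le_one hden]
    have hβ5 : β ^ 5 ≤ (β ^ 3) ^ 2 := by
      rw [← pow_mul, show 3 * 2 = 5 + 1 from rfl, pow_succ]
      exact le_mul_of_one_le_right (by positivity) (by linarith)
    calc β ^ 5 * Λ ^ 4 ≤ (β ^ 3) ^ 2 * (1 / 2 ^ 20) := mul_le_mul hβ5 hΛ4 (by positivity) (by positivity)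
      _ ≤ 4 * Real.pi ^ 2 * (2 * M - 3) ^ 2 := by nlinarith [pow_pos hβ0 3]
  have hpos : 0 ≤ 2 / Λ + 128 * Real.pi ^ 4 * (4 * B₂ + 6 * B₁ + 2) ^ 2 / Λ +
      256 * Real.pi ^ 5 * (4 * B₂ + 6 * B₁ + 2) ^ 2 / (β * Λ ^ 2) + β ^ 5 * Λ ^ 4 / (4 * Real.pi ^ 2 * (2 * M - 3) ^ 2) +
      Real.pi ^ 4 * ((7 : ℝ) ^ 2 * (4 * B₂ + 6 * B₁ + 2) * (2 / Λ) + 7 * (2 * B₁ + 1)) ^ 2 / Λ ^ 3 := by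
    have : (0 : ℝ) < 2 * M - 3 := by linarith
    positivity
  refine mul_le_mul h1 ?_ hpos (by positivity)
  linarith

/-- **The mass, rows**: for an admissible frame, `klBetaMin ≤ β`, `β³ ≤ M`, `2M ≤ N`, `0 < Λ ≤ klE0`,
`(β/N)·Σ_Y ‖(S_Nᵀ C^K_{>Λ} S_N) X Y‖ ≤ 14·√((½ + 12/Λ)(2/Λ + 128π⁴K₂²/Λ + 2π⁵K₂²/Λ² + 1 + π⁴K_x²/Λ³))` — uniform in `L`, `M`, `N`, `μ`, `U`,
the frame (BGM 2006 (4.8b), `j = 0`: `‖G^{(h)}‖₁ ≤ Cγ^{-h}`; the `β/N` is the time weight of a grid point). -/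
theorem alpha_uvCov_row_le (hK : FrameOK R U Nsc μ K) (hβ : klBetaMin ≤ β)
    (hB₁ : ∀ x, |deriv salmhoferCutoff x| ≤ B₁) (hB₂ : ∀ x, |deriv (deriv salmhoferCutoff) x| ≤ B₂) (hβM : β ^ 3 ≤ (M : ℝ))
    (hΛ : 0 < Λ) (hΛe : Λ ≤ klE0) (hMN : 2 * M ≤ N) (X : GridLeg (GridPoint L N)) :
    β / N * ∑ Y : GridLeg (GridPoint L N),
        ‖((hubbardGridSub L M β N).transpose * hubbardCovAboveCT L M β μ 0 K Λ * hubbardGridSub L M β N) X Y‖ ≤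
      14 * Real.sqrt ((1 / 2 + 12 / Λ) *
        (2 / Λ + 128 * Real.pi ^ 4 * (4 * B₂ + 6 * B₁ + 2) ^ 2 / Λ + 2 * Real.pi ^ 5 * (4 * B₂ + 6 * B₁ + 2) ^ 2 / Λ ^ 2 + 1 +
          Real.pi ^ 4 * ((7 : ℝ) ^ 2 * (4 * B₂ + 6 * B₁ + 2) * (2 / Λ) + 7 * (2 * B₁ + 1)) ^ 2 / Λ ^ 3)) := by
  have hβ0 : 0 < β := beta_pos_of_klBetaMin_le hβ
  have hβ128 : (128 : ℝ) ≤ β := by simpa [klBetaMin] using hβ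
  have hβ3 : β ≤ β ^ 3 := by nlinarith [sq_nonneg β]
  have hMr : β ≤ (M : ℝ) := hβ3.trans hβM
  have hM2 : 2 ≤ M := by
    have : (2 : ℝ) ≤ M := by linarith
    exact_mod_cast this
  have hNr : 2 * (M : ℝ) ≤ N := by exact_mod_cast hMN
  have hN0 : 0 < (N : ℝ) := by linarith
  have hs₀pos : 0 < β * Λ / N := by positivity
  have hrow := rowSum_gridSub_hubbardCovAboveCT_le (L := L) hβ0 hΛ hB₁ hB₂ (by norm_num) (uvLineBound_of_frameOK hK) hM2 hMN hs₀pos X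
  exact mul_le_fourteen_sqrt_of_le hrow (by positivity) (by positivity) (radicand_uvCov_le (L := L) hβ hB₁ hB₂ hβM hΛ hΛe hMN)

/-- **The mass, columns**: the same bound for `(β/N)·Σ_X ‖(S_Nᵀ C^K_{>Λ} S_N) X Y‖`. -/
theorem alpha_uvCov_col_le (hK : FrameOK R U Nsc μ K) (hβ : klBetaMin ≤ β)
    (hB₁ : ∀ x, |deriv salmhoferCutoff x| ≤ B₁) (hB₂ : ∀ x, |deriv (deriv salmhoferCutoff) x| ≤ B₂) (hβM : β ^ 3 ≤ (M : ℝ))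
    (hΛ : 0 < Λ) (hΛe : Λ ≤ klE0) (hMN : 2 * M ≤ N) (Y : GridLeg (GridPoint L N)) :
    β / N * ∑ X : GridLeg (GridPoint L N),
        ‖((hubbardGridSub L M β N).transpose * hubbardCovAboveCT L M β μ 0 K Λ * hubbardGridSub L M β N) X Y‖ ≤
      14 * Real.sqrt ((1 / 2 + 12 / Λ) *
        (2 / Λ + 128 * Real.pi ^ 4 * (4 * B₂ + 6 * B₁ + 2) ^ 2 / Λ + 2 * Real.pi ^ 5 * (4 * B₂ + 6 * B₁ + 2) ^ 2 / Λ ^ 2 + 1 +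
          Real.pi ^ 4 * ((7 : ℝ) ^ 2 * (4 * B₂ + 6 * B₁ + 2) * (2 / Λ) + 7 * (2 * B₁ + 1)) ^ 2 / Λ ^ 3)) := by
  have hβ0 : 0 < β := beta_pos_of_klBetaMin_le hβ
  have hβ128 : (128 : ℝ) ≤ β := by simpa [klBetaMin] using hβ
  have hβ3 : β ≤ β ^ 3 := by nlinarith [sq_nonneg β]
  have hMr : β ≤ (M : ℝ) := hβ3.trans hβM
  have hM2 : 2 ≤ M := by
    have : (2 : ℝ) ≤ M := by linarith
    exact_mod_cast this
  have hNr : 2 * (M : ℝ) ≤ N := by exact_mod_cast hMN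
  have hN0 : 0 < (N : ℝ) := by linarith
  have hs₀pos : 0 < β * Λ / N := by positivity
  have hcol := colSum_gridSub_hubbardCovAboveCT_le (L := L) hβ0 hΛ hB₁ hB₂ (by norm_num) (uvLineBound_of_frameOK hK) hM2 hMN hs₀pos Y
  exact mul_le_fourteen_sqrt_of_le hcol (by positivity) (by positivity) (radicand_uvCov_le (L := L) hβ hB₁ hB₂ hβM hΛ hΛe hMN)

/-- **Rows at the tree's cutoff numerals** (`|χ₂′| ≤ 32/3`, `|χ₂″| ≤ 1110`): `Σ_Y ‖G X Y‖ ≤ (N/β)·A₀(Λ)`, `A₀(Λ)` the displayed closed form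
(`A₀(klE0) = klScaleZeroA0`). -/
theorem rowSum_uvCov_le (hK : FrameOK R U Nsc μ K) (hβ : klBetaMin ≤ β) (hβM : β ^ 3 ≤ (M : ℝ)) (hΛ : 0 < Λ) (hΛe : Λ ≤ klE0)
    (hMN : 2 * M ≤ N) (X : GridLeg (GridPoint L N)) :
    ∑ Y : GridLeg (GridPoint L N), ‖((hubbardGridSub L M β N).transpose * hubbardCovAboveCT L M β μ 0 K Λ * hubbardGridSub L M β N) X Y‖ ≤
      (N : ℝ) / β * (14 * Real.sqrt ((1 / 2 + 12 / Λ) *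
        (2 / Λ + 128 * Real.pi ^ 4 * (4 * (1110 : ℝ) + 6 * (32 / 3) + 2) ^ 2 / Λ +
          2 * Real.pi ^ 5 * (4 * (1110 : ℝ) + 6 * (32 / 3) + 2) ^ 2 / Λ ^ 2 + 1 +
          Real.pi ^ 4 * ((7 : ℝ) ^ 2 * (4 * (1110 : ℝ) + 6 * (32 / 3) + 2) * (2 / Λ) + 7 * (2 * (32 / 3) + 1)) ^ 2 / Λ ^ 3))) := by
  have hβ0 : 0 < β := beta_pos_of_klBetaMin_le hβ
  have hβ128 : (128 : ℝ) ≤ β := by simpa [klBetaMin] using hβ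
  have hβ3 : β ≤ β ^ 3 := by nlinarith [sq_nonneg β]
  have hNr : 2 * (M : ℝ) ≤ N := by exact_mod_cast hMN
  have hN0 : 0 < (N : ℝ) := by linarith [hβ3.trans hβM]
  have h := alpha_uvCov_row_le (L := L) hK hβ klsv_B₁ klsv_B₂ hβM hΛ hΛe hMN X
  rw [div_mul_eq_mul_div, div_le_iff₀ hN0] at h
  rw [div_mul_eq_mul_div, le_div_iff₀ hβ0]
  linarith

/-- **Columns at the tree's cutoff numerals**: `Σ_X ‖G X Y‖ ≤ (N/β)·A₀(Λ)`. -/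
theorem colSum_uvCov_le (hK : FrameOK R U Nsc μ K) (hβ : klBetaMin ≤ β) (hβM : β ^ 3 ≤ (M : ℝ)) (hΛ : 0 < Λ) (hΛe : Λ ≤ klE0)
    (hMN : 2 * M ≤ N) (Y : GridLeg (GridPoint L N)) :
    ∑ X : GridLeg (GridPoint L N), ‖((hubbardGridSub L M β N).transpose * hubbardCovAboveCT L M β μ 0 K Λ * hubbardGridSub L M β N) X Y‖ ≤
      (N : ℝ) / β * (14 * Real.sqrt ((1 / 2 + 12 / Λ) *
        (2 / Λ + 128 * Real.pi ^ 4 * (4 * (1110 : ℝ) + 6 * (32 / 3) + 2) ^ 2 / Λ +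
          2 * Real.pi ^ 5 * (4 * (1110 : ℝ) + 6 * (32 / 3) + 2) ^ 2 / Λ ^ 2 + 1 +
          Real.pi ^ 4 * ((7 : ℝ) ^ 2 * (4 * (1110 : ℝ) + 6 * (32 / 3) + 2) * (2 / Λ) + 7 * (2 * (32 / 3) + 1)) ^ 2 / Λ ^ 3))) := by
  have hβ0 : 0 < β := beta_pos_of_klBetaMin_le hβ
  have hβ128 : (128 : ℝ) ≤ β := by simpa [klBetaMin] using hβ
  have hβ3 : β ≤ β ^ 3 := by nlinarith [sq_nonneg β]
  have hNr : 2 * (M : ℝ) ≤ N := by exact_mod_cast hMN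
  have hN0 : 0 < (N : ℝ) := by linarith [hβ3.trans hβM]
  have h := alpha_uvCov_col_le (L := L) hK hβ klsv_B₁ klsv_B₂ hβM hΛ hΛe hMN Y
  rw [div_mul_eq_mul_div, div_le_iff₀ hN0] at h
  rw [div_mul_eq_mul_div, le_div_iff₀ hβ0]
  linarith

/-- At `Λ = klE0` the displayed constant IS `klScaleZeroA0` (sanity link to the scale-`0` packaging). -/
theorem A0At_klE0_eq : 14 * Real.sqrt ((1 / 2 + 12 / klE0) *
        (2 / klE0 + 128 * Real.pi ^ 4 * (4 * (1110 : ℝ) + 6 * (32 / 3) + 2) ^ 2 / klE0 +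
          2 * Real.pi ^ 5 * (4 * (1110 : ℝ) + 6 * (32 / 3) + 2) ^ 2 / klE0 ^ 2 + 1 +
          Real.pi ^ 4 * ((7 : ℝ) ^ 2 * (4 * (1110 : ℝ) + 6 * (32 / 3) + 2) * (2 / klE0) + 7 * (2 * (32 / 3) + 1)) ^ 2 / klE0 ^ 3)) =
      klScaleZeroA0 := rfl

end Alpha

/-! ## §2 The first TIME moment at every cutoff `0 < Λ` -/

section Time

variable [NeZero L] [NeZero N] {R : RenConsts} {U : ℝ} {Nsc : ℕ} {μ : ℝ} {K : TrigPolyC4v} {β Λ : ℝ}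

/-- **The first TIME moment** of `C^K_{>Λ}` of an admissible frame, in grid units, uniform in `L`, `M`, `N`, `μ`, `U`, the frame:
for `FrameOK`, `klBetaMin ≤ β`, `β³ ≤ M`, `2M ≤ N`, any `0 < Λ`, any space scale `R ≥ 1`, every spin `σ`,
`(β/N)·Σ_{a,b⃗} (β/N)|ã|·‖S[G_σ](a,b⃗)‖ ≤ uvTimeMomentConst Λ 7 R` (BGM 2006 (4.8b), `j = 1`, time direction). -/
theorem timeMoment_uvCov_of_frameOK (hK : FrameOK R U Nsc μ K) (hβ : klBetaMin ≤ β) (hβM : β ^ 3 ≤ (M : ℝ)) (hMN : 2 * M ≤ N)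
    (hΛ : 0 < Λ) {Rs : ℕ} (hRs : 1 ≤ Rs) (σ : Fin 2) :
    β / N * ∑ a : TorusSite 1 N, ∑ bv : TorusSite 2 L,
        β / N * |(((a 0).valMinAbs : ℤ) : ℝ)| *
          ‖∑ q₀ : TorusSite 1 N, ∑ qv : TorusSite 2 L,
            torusChar q₀ a * torusChar qv bv * gridSymbol L M N β (uvSymbolCT L M β μ K Λ) σ q₀ qv‖ ≤
      uvTimeMomentConst Λ 7 Rs := by
  have hβ2 : (2 : ℝ) ≤ β := le_trans (by norm_num [klBetaMin]) hβ
  exact timeMoment_charSum_uvSymbolCT_le hβ2 hΛ (by norm_num) (uvSurfaceBound_of_frameOK hK) hβM hMN hRs σ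

end Time

end Summit.HubbardSuperconductivity.HubbardSuperconductivity.Theorems.UVCovarianceAt

end
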